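import Summits.ResolutionOfSingularities.ResolutionOfSingularities.Theorems.EquisingularLiftEquisingularLiftNatExactShadow
import Summits.ResolutionOfSingularities.ResolutionOfSingularities.Theorems.EquisingularLiftEquisingularLiftNatPointResolution
import Summits.ResolutionOfSingularities.ResolutionOfSingularities.Theorems.EquisingularLiftEquisingularLiftNatHorizChain
import Summits.ResolutionOfSingularities.ResolutionOfSingularities.Theorems.EquisingularLiftCampaignW45bELNatAt
import HarnessLib

/-!
# [OURS · L1 W4.5(b) · EL♮] T-EXACT-SHADOW in the item's spelling: `ELNatOver` from a downstairs resolution by blow-ups in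
# singular centres with exact admissible lifts, any `n` (res-L1-w45b-lead-2's TARGET (6) 2026-08-27T07:06:48Z, file 2 of 2)

Crux `EquisingularLiftNat` = stmt-ResolutionOfSingularities-20038 (route EquisingularLift), line `sections`; helper file
`--supports … --as helper` by res-D-pv-037 (pool seat, TAKING 2026-08-27T07:19:43Z). HONEST FRAMING: OURS (cell res-hironaka,
slot W4.5(b)); NOT a statement of any manuscript; a CONDITIONAL rung — the exact-lift hypothesis `(MS)` and the downstairs
resolution `(DOWN)` are explicit binders, discharged nowhere here. AI-written, weaker than expert review. No `sorry`; standard axioms.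

* `elNatOver_of_exactShadow` — fixed ambient `P = ℙⁿ_O` over a characteristic-0 DVR `O` with a surjection `π : O → k`, `H ⊆ ℙⁿ_k`
  integral, `Y = (ι ≫ Proj.map φ)(H)`; PARAMETER `Adm Γ D` (iso-invariant admissibility of a downstairs centre); `(DOWN)` `H` reaches a
  regular scheme by finitely many blow-ups along `Adm`-admissible ideal sheaves supported in non-regular loci (inductive closure,
  intrinsic); `(MS)` at every stage of the HORIZONTAL-E1 closure of `(ℙⁿ_O, 𝟙, Y)` every such centre of the reduced strict transform
  has an EXACT admissible lift (regular, `O`-flat, E1, `C.comap ι = D`). THEN `Theorems.EquisingularLift.ELNatOver p k n H ι O π`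
  (p503491): the engine `horizChainE1_of_exactShadow` (file 1) started at `(ℙⁿ_O, 𝟙, Y)` with `H ≅ V(Y)_red`, then
  `natChain_and_isIrreducible_of_horizChainE1` (p500485) for the item's E1 clause and the irreducible special fibre.
* `elNatOver_of_isSingularBlowupSequence` / `elNatAt_of_isSingularBlowupSequence` — `Adm := ⊤`: the downstairs hypothesis is
  literally «`∃ π : H' → H`, `Literature…Resolution.IsSingularBlowupSequence π ∧ H' regular`» (for `n = 3` an instance of the named
  fact `CossartJannsenSaito2020Sequence` once `H` is fed as a reduced excellent scheme of dimension `≤ 2`), plus `(MS)` for every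
  ideal sheaf of every reduced strict transform supported in its non-regular locus.

References: …NatExactShadow.lean (file 1), …NatPointResolution.lean (T-ISO-0 p505885, whose fixed-ambient glue is reused verbatim),
…NatHorizChain.lean (p500485), …CampaignW45bELNatAt.lean (p503491); Liu 2002 §8.1; L/w45b/CHAIN.md v7.2.
-/

set_option linter.dupNamespace false -- mandated namespace `Summit.<Summit>.<Problem>` of this single-conjunct summit
set_option linter.overlappingInstances false -- signatures carry `[IsDomain O] [IsDiscreteValuationRing O]`

noncomputable section

open CategoryTheory CategoryTheory.Limits AlgebraicGeometry TopologicalSpace Topology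
open MvPolynomial HomogeneousIdeal
open Literature.AlgebraicGeometry.Resolution
open AlgebraicGeometry.Scheme.IdealSheafData
open Summit.ResolutionOfSingularities.ResolutionOfSingularities.Theses.EquisingularLift.Split
open Summit.ResolutionOfSingularities.ResolutionOfSingularities.Cruxes.EquisingularLift.StrataSplit

namespace Summit.ResolutionOfSingularities.ResolutionOfSingularities.Cruxes.EquisingularLiftNat.Sections

/-- **T-EXACT-SHADOW ⇒ `ELNatOver`** (see the module docstring): for the fixed ambient `ℙⁿ_O` and `Y = (ι ≫ Proj.map φ)(H)`, a
downstairs resolution of `H` by blow-ups in `Adm`-admissible singular centres together with exact admissible lifts of all such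
centres at all horizontal-E1 stages gives EL♮ for `H` over `(O, π)`. [folklore; Liu 2002 §8.1] -/
theorem elNatOver_of_exactShadow {p : ℕ} (k : Type) [Field k] [CharP k p] [IsAlgClosed k] (n : ℕ) (H : Scheme.{0})
    (ι : H ⟶ (Literature.AlgebraicGeometry.Motives.projectiveSpace n k).left) [IsClosedImmersion ι] [IsIntegral H]
    (O : Type) [CommRing O] [IsDomain O] [IsDiscreteValuationRing O] [CharZero O] (π : O →+* k)
    (hπ : Function.Surjective π)
    (Adm : ∀ Γ : Scheme.{0}, Γ.IdealSheafData → Prop)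
    (hAdm : ∀ (Γ Γ' : Scheme.{0}) (e : Γ ≅ Γ') (D : Γ.IdealSheafData), Adm Γ D → Adm Γ' (D.comap e.inv))
    (hdown : ∃ Γs : Scheme.{0}, (∀ R : Scheme.{0} → Prop, R H →
      (∀ (Γ₁ Γ₂ : Scheme.{0}) (D : Γ₁.IdealSheafData) (υ : Γ₂ ⟶ Γ₁), R Γ₁ →
        (D.support : Set Γ₁) ⊆ (Scheme.regularLocus Γ₁)ᶜ → Adm Γ₁ D → IsBlowup υ D → R Γ₂) → R Γs) ∧
      Scheme.IsRegular Γs)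
    (hMS : letI := MvPolynomial.gradedAlgebra (σ := Fin (n + 1)) (R := O);
      letI := MvPolynomial.gradedAlgebra (σ := Fin (n + 1)) (R := k);
      ∀ (φ : homogeneousSubmodule (Fin (n + 1)) O →+*ᵍ homogeneousSubmodule (Fin (n + 1)) k)
        (hφ' : HomogeneousIdeal.irrelevant (homogeneousSubmodule (Fin (n + 1)) k) ≤
          (HomogeneousIdeal.irrelevant (homogeneousSubmodule (Fin (n + 1)) O)).map φ),
        (∀ s, φ s = MvPolynomial.map π s) →
      ∀ (X₁ : Scheme.{0}) (σ₁ : X₁ ⟶ Proj (homogeneousSubmodule (Fin (n + 1)) O)) (S₁ : Set X₁),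
        (∀ Q : (∀ X' : Scheme.{0}, (X' ⟶ Proj (homogeneousSubmodule (Fin (n + 1)) O)) → Set X' → Prop),
          Q (Proj (homogeneousSubmodule (Fin (n + 1)) O)) (𝟙 _) (Set.range (ι ≫ Proj.map φ hφ')) →
          (∀ (X' X'' : Scheme.{0}) (σ' : X' ⟶ Proj (homogeneousSubmodule (Fin (n + 1)) O)) (Y' : Set X')
            (C : X'.IdealSheafData) (τ : X'' ⟶ X'), Q X' σ' Y' → IsBlowup τ C → Scheme.IsRegular C.subscheme →
            Flat (C.subschemeι ≫ σ' ≫ Proj.toSpecZero (homogeneousSubmodule (Fin (n + 1)) O) ≫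
              Spec.map (CommRingCat.ofHom (algebraMap O (homogeneousSubmodule (Fin (n + 1)) O 0)))) →
            σ' '' (C.support : Set X') ⊆ {x | ¬ IsGenericPoint x (Set.range (ι ≫ Proj.map φ hφ'))} →
            (C.support : Set X') ∩ (σ' ≫ Proj.toSpecZero (homogeneousSubmodule (Fin (n + 1)) O) ≫
              Spec.map (CommRingCat.ofHom (algebraMap O (homogeneousSubmodule (Fin (n + 1)) O 0)))) ⁻¹'
              {IsLocalRing.closedPoint O} ⊆ Y' →
            Q X'' (τ ≫ σ') (closure (τ ⁻¹' (Y' \ (C.support : Set X'))))) → Q X₁ σ₁ S₁) →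
        IsLocallyNoetherian X₁ → Scheme.IsRegular X₁ →
        IsProper (σ₁ ≫ Proj.toSpecZero (homogeneousSubmodule (Fin (n + 1)) O) ≫
          Spec.map (CommRingCat.ofHom (algebraMap O (homogeneousSubmodule (Fin (n + 1)) O 0)))) →
        IsClosed S₁ → IsIrreducible S₁ →
        S₁ ⊆ (σ₁ ≫ Proj.toSpecZero (homogeneousSubmodule (Fin (n + 1)) O) ≫
          Spec.map (CommRingCat.ofHom (algebraMap O (homogeneousSubmodule (Fin (n + 1)) O 0)))) ⁻¹'
          {IsLocalRing.closedPoint O} →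
        ∀ D : ((vanishingIdeal (⟨closure S₁, isClosed_closure⟩ : Closeds X₁)).subscheme).IdealSheafData,
          (D.support : Set ↥(vanishingIdeal (⟨closure S₁, isClosed_closure⟩ : Closeds X₁)).subscheme) ⊆
            (Scheme.regularLocus (vanishingIdeal (⟨closure S₁, isClosed_closure⟩ : Closeds X₁)).subscheme)ᶜ →
          Adm (vanishingIdeal (⟨closure S₁, isClosed_closure⟩ : Closeds X₁)).subscheme D →
          ∃ C : X₁.IdealSheafData, Scheme.IsRegular C.subscheme ∧
            Flat (C.subschemeι ≫ σ₁ ≫ Proj.toSpecZero (homogeneousSubmodule (Fin (n + 1)) O) ≫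
              Spec.map (CommRingCat.ofHom (algebraMap O (homogeneousSubmodule (Fin (n + 1)) O 0)))) ∧
            (C.support : Set X₁) ∩ (σ₁ ≫ Proj.toSpecZero (homogeneousSubmodule (Fin (n + 1)) O) ≫
              Spec.map (CommRingCat.ofHom (algebraMap O (homogeneousSubmodule (Fin (n + 1)) O 0)))) ⁻¹'
              {IsLocalRing.closedPoint O} ⊆ S₁ ∧
            C.comap (vanishingIdeal (⟨closure S₁, isClosed_closure⟩ : Closeds X₁)).subschemeι = D) :
    Theorems.EquisingularLift.ELNatOver p k n H ι O π := by
  classical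
  letI := MvPolynomial.gradedAlgebra (σ := Fin (n + 1)) (R := O)
  letI := MvPolynomial.gradedAlgebra (σ := Fin (n + 1)) (R := k)
  intro φ hφ' hφ Y hYdef
  subst hYdef
  -- the fixed ambient `P = ℙⁿ_O`, its structure morphism `q`, and the closed immersion `g : ℙⁿ_k ⟶ ℙⁿ_O` onto the special fibre
  set q : Proj (homogeneousSubmodule (Fin (n + 1)) O) ⟶ Spec (.of O) :=
    Proj.toSpecZero (homogeneousSubmodule (Fin (n + 1)) O) ≫
      Spec.map (CommRingCat.ofHom (algebraMap O (homogeneousSubmodule (Fin (n + 1)) O 0))) with hq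
  have hP := ProjectiveAmbientFibre.isPullback_projMap π φ hφ hπ hφ'
  set g : Proj (homogeneousSubmodule (Fin (n + 1)) k) ⟶ Proj (homogeneousSubmodule (Fin (n + 1)) O) :=
    Proj.map φ hφ' with hg
  haveI : IsClosedImmersion (Spec.map (CommRingCat.ofHom π)) := IsClosedImmersion.spec_of_surjective _ hπ
  haveI : IsClosedImmersion g := MorphismProperty.IsStableUnderBaseChange.of_isPullback hP.flip inferInstance
  have hpt : ∀ x : Spec (.of k), Spec.map (CommRingCat.ofHom π) x = IsLocalRing.closedPoint O := by
    intro x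
    rw [Spec.map_apply]
    apply PrimeSpectrum.ext
    rw [PrimeSpectrum.comap_asIdeal, CommRingCat.hom_ofHom, Ideal.eq_bot_of_prime x.asIdeal, ← RingHom.ker_eq_comap_bot]
    exact IsLocalRing.eq_maximalIdeal (RingHom.ker_isMaximal_of_surjective π hπ)
  have hgq : ∀ x, q (g x) = IsLocalRing.closedPoint O := fun x ↦
    (Scheme.Hom.comp_apply g q x).symm.trans
      ((congrArg (fun h : Proj (homogeneousSubmodule (Fin (n + 1)) k) ⟶ Spec (.of O) ↦ h x) hP.w).trans
        ((Scheme.Hom.comp_apply _ _ x).trans (hpt _)))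
  -- the closed immersion `f = ι ≫ g : H ⟶ ℙⁿ_O` and its (closed) range `Y`
  let ι' : H ⟶ Proj (homogeneousSubmodule (Fin (n + 1)) k) := ι
  haveI : IsClosedImmersion ι' := ‹IsClosedImmersion ι›
  let f : H ⟶ Proj (homogeneousSubmodule (Fin (n + 1)) O) := ι' ≫ g
  let Yc : Closeds (Proj (homogeneousSubmodule (Fin (n + 1)) O)) := ⟨Set.range f, f.isClosedEmbedding.isClosed_range⟩
  have hYc : (Yc : Set (Proj (homogeneousSubmodule (Fin (n + 1)) O))) = Set.range (ι ≫ Proj.map φ hφ') := rfl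
  have hsub : (Yc : Set (Proj (homogeneousSubmodule (Fin (n + 1)) O))) ⊆ q ⁻¹' {IsLocalRing.closedPoint O} := by
    rintro _ ⟨x, rfl⟩
    show q (f x) = IsLocalRing.closedPoint O
    rw [show f x = g (ι' x) from Scheme.Hom.comp_apply _ _ x]
    exact hgq (ι' x)
  obtain ⟨hsm, hprop⟩ := stub_projectiveAmbientSmoothProper O n
  have hint := isIntegral_specialFibre_projectiveSpace O n
  -- `H` is reduced: `V(Y)_red ≅ H`
  obtain ⟨e⟩ := nonempty_iso_subscheme_vanishingIdeal_range f
  -- `Y` is irreducible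
  have hgen : IsGenericPoint (f (genericPoint H)) (Yc : Set (Proj (homogeneousSubmodule (Fin (n + 1)) O))) := by
    have h := (genericPoint_spec H).image f.continuous
    rwa [Set.image_univ, f.isClosedEmbedding.isClosed_range.closure_eq] at h
  have hYirr : IsIrreducible (Yc : Set (Proj (homogeneousSubmodule (Fin (n + 1)) O))) := by
    have h := (isIrreducible_singleton (x := f (genericPoint H))).closure
    rwa [hgen] at h
  -- EL♮'s HORIZONTAL induction principle as a stage predicate over the fixed base
  obtain ⟨Ch, hCh⟩ : ∃ Ch : ∀ X' : Scheme.{0}, (X' ⟶ Proj (homogeneousSubmodule (Fin (n + 1)) O)) → Set X' → Prop,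
      ∀ (X₁ : Scheme.{0}) (σ₁ : X₁ ⟶ Proj (homogeneousSubmodule (Fin (n + 1)) O)) (S₁ : Set X₁), Ch X₁ σ₁ S₁ ↔
      ∀ Q : (∀ X' : Scheme.{0}, (X' ⟶ Proj (homogeneousSubmodule (Fin (n + 1)) O)) → Set X' → Prop),
        Q (Proj (homogeneousSubmodule (Fin (n + 1)) O)) (𝟙 _) (Yc : Set (Proj (homogeneousSubmodule (Fin (n + 1)) O))) →
        (∀ (X' X'' : Scheme.{0}) (σ' : X' ⟶ Proj (homogeneousSubmodule (Fin (n + 1)) O)) (Y' : Set X')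
          (C : X'.IdealSheafData) (τ : X'' ⟶ X'), Q X' σ' Y' → IsBlowup τ C → Scheme.IsRegular C.subscheme →
          Flat (C.subschemeι ≫ σ' ≫ q) →
          σ' '' (C.support : Set X') ⊆ {x | ¬ IsGenericPoint x (Yc : Set (Proj (homogeneousSubmodule (Fin (n + 1)) O)))} →
          (C.support : Set X') ∩ (σ' ≫ q) ⁻¹' {IsLocalRing.closedPoint O} ⊆ Y' →
          Q X'' (τ ≫ σ') (closure (τ ⁻¹' (Y' \ (C.support : Set X'))))) →
        Q X₁ σ₁ S₁ := ⟨_, fun _ _ _ => Iff.rfl⟩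
  have hChain : ∀ (X' : Scheme.{0}) (σ : X' ⟶ Proj (homogeneousSubmodule (Fin (n + 1)) O)) (S : Set X'),
      Ch X' σ S → Chain (Proj (homogeneousSubmodule (Fin (n + 1)) O))
        (Yc : Set (Proj (homogeneousSubmodule (Fin (n + 1)) O))) X' σ S :=
    fun X' σ S h Q h0 hs => (hCh X' σ S).mp h Q h0
      (fun X₁ X₂ σ' Y' C τ hQ hb hr _ hg' _ => hs X₁ X₂ σ' Y' C τ hQ hb hr hg')
  have hStep : ∀ (X' X'' : Scheme.{0}) (σ' : X' ⟶ Proj (homogeneousSubmodule (Fin (n + 1)) O)) (S' : Set X')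
      (C : X'.IdealSheafData) (τ : X'' ⟶ X'),
      Ch X' σ' S' → IsBlowup τ C → Scheme.IsRegular C.subscheme → Flat (C.subschemeι ≫ σ' ≫ q) →
      σ' '' (C.support : Set X') ⊆ {x | ¬ IsGenericPoint x (Yc : Set (Proj (homogeneousSubmodule (Fin (n + 1)) O)))} →
      (C.support : Set X') ∩ (σ' ≫ q) ⁻¹' {IsLocalRing.closedPoint O} ⊆ S' →
      Ch X'' (τ ≫ σ') (closure (τ ⁻¹' (S' \ (C.support : Set X')))) :=
    fun X' X'' σ' S' C τ h hb hr hfl hg' hE => (hCh _ _ _).mpr fun Q h0 hs =>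
      hs X' X'' σ' S' C τ ((hCh X' σ' S').mp h Q h0 hs) hb hr hfl hg' hE
  have hCh₀ : Ch (Proj (homogeneousSubmodule (Fin (n + 1)) O)) (𝟙 _)
      (Yc : Set (Proj (homogeneousSubmodule (Fin (n + 1)) O))) := (hCh _ _ _).mpr fun Q h0 _ => h0
  -- the base isomorphism `H ≅ V(closure Y)_red`
  have hZ2 : (⟨closure (Yc : Set (Proj (homogeneousSubmodule (Fin (n + 1)) O))), isClosed_closure⟩ :
      Closeds (Proj (homogeneousSubmodule (Fin (n + 1)) O))) = Yc := Closeds.ext Yc.isClosed.closure_eq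
  have e₀ : H ≅ (vanishingIdeal (⟨closure (Yc : Set (Proj (homogeneousSubmodule (Fin (n + 1)) O))), isClosed_closure⟩ :
      Closeds (Proj (homogeneousSubmodule (Fin (n + 1)) O)))).subscheme := by
    rw [hZ2]
    exact e.symm
  -- (MS) for the opaque stage predicate
  have hMS' : ∀ (X₁ : Scheme.{0}) (σ₁ : X₁ ⟶ Proj (homogeneousSubmodule (Fin (n + 1)) O)) (S₁ : Set X₁),
      Ch X₁ σ₁ S₁ → IsLocallyNoetherian X₁ → Scheme.IsRegular X₁ → IsProper (σ₁ ≫ q) → IsClosed S₁ → IsIrreducible S₁ →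
      S₁ ⊆ (σ₁ ≫ q) ⁻¹' {IsLocalRing.closedPoint O} →
      ∀ D : ((vanishingIdeal (⟨closure S₁, isClosed_closure⟩ : Closeds X₁)).subscheme).IdealSheafData,
        (D.support : Set ↥(vanishingIdeal (⟨closure S₁, isClosed_closure⟩ : Closeds X₁)).subscheme) ⊆
          (Scheme.regularLocus (vanishingIdeal (⟨closure S₁, isClosed_closure⟩ : Closeds X₁)).subscheme)ᶜ →
        Adm (vanishingIdeal (⟨closure S₁, isClosed_closure⟩ : Closeds X₁)).subscheme D →
        ∃ C : X₁.IdealSheafData, Scheme.IsRegular C.subscheme ∧ Flat (C.subschemeι ≫ σ₁ ≫ q) ∧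
          (C.support : Set X₁) ∩ (σ₁ ≫ q) ⁻¹' {IsLocalRing.closedPoint O} ⊆ S₁ ∧
          C.comap (vanishingIdeal (⟨closure S₁, isClosed_closure⟩ : Closeds X₁)).subschemeι = D :=
    fun X₁ σ₁ S₁ h => hMS φ hφ' hφ X₁ σ₁ S₁ ((hCh X₁ σ₁ S₁).mp h)
  -- the engine
  obtain ⟨X₁, σ₁, S₁, hCh₁, hreg₁⟩ := horizChainE1_of_exactShadow O (Proj (homogeneousSubmodule (Fin (n + 1)) O)) q Yc
    Ch hChain hStep hsm hprop hsub hYirr Adm hAdm hMS' _ (𝟙 _) _ hCh₀ H e₀ hdown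
  -- the item's E1 clause and the irreducible special fibre (p500485)
  obtain ⟨hch, hirr⟩ := natChain_and_isIrreducible_of_horizChainE1 O _ X₁ q
    (Yc : Set (Proj (homogeneousSubmodule (Fin (n + 1)) O))) σ₁ S₁ hsm hprop hint hYirr Yc.isClosed hsub
    ((hCh X₁ σ₁ S₁).mp hCh₁)
  exact ⟨X₁, σ₁, S₁, hch, hirr, hreg₁⟩

/-- **`ELNatOver` FROM A DOWNSTAIRS `IsSingularBlowupSequence` WITH EXACT ADMISSIBLE LIFTS** (`Adm := ⊤`): if `H` is resolved
by a finite sequence of blow-ups in singular centres (`Literature…Resolution.IsSingularBlowupSequence π`, `π : H' → H`, `H'` regular —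
Cossart–Jannsen–Saito's printed structure) and at every horizontal-E1 stage every ideal sheaf of the reduced strict transform
supported in its non-regular locus has an exact admissible lift, then `ELNatOver p k n H ι O π`. [folklore; Liu 2002 §8.1] -/
theorem elNatOver_of_isSingularBlowupSequence {p : ℕ} (k : Type) [Field k] [CharP k p] [IsAlgClosed k] (n : ℕ)
    (H : Scheme.{0}) (ι : H ⟶ (Literature.AlgebraicGeometry.Motives.projectiveSpace n k).left) [IsClosedImmersion ι]
    [IsIntegral H] (O : Type) [CommRing O] [IsDomain O] [IsDiscreteValuationRing O] [CharZero O] (π : O →+* k)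
    (hπ : Function.Surjective π)
    (hres : ∃ (H' : Scheme.{0}) (ρ : H' ⟶ H), IsSingularBlowupSequence ρ ∧ Scheme.IsRegular H')
    (hMS : letI := MvPolynomial.gradedAlgebra (σ := Fin (n + 1)) (R := O);
      letI := MvPolynomial.gradedAlgebra (σ := Fin (n + 1)) (R := k);
      ∀ (φ : homogeneousSubmodule (Fin (n + 1)) O →+*ᵍ homogeneousSubmodule (Fin (n + 1)) k)
        (hφ' : HomogeneousIdeal.irrelevant (homogeneousSubmodule (Fin (n + 1)) k) ≤
          (HomogeneousIdeal.irrelevant (homogeneousSubmodule (Fin (n + 1)) O)).map φ),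
        (∀ s, φ s = MvPolynomial.map π s) →
      ∀ (X₁ : Scheme.{0}) (σ₁ : X₁ ⟶ Proj (homogeneousSubmodule (Fin (n + 1)) O)) (S₁ : Set X₁),
        (∀ Q : (∀ X' : Scheme.{0}, (X' ⟶ Proj (homogeneousSubmodule (Fin (n + 1)) O)) → Set X' → Prop),
          Q (Proj (homogeneousSubmodule (Fin (n + 1)) O)) (𝟙 _) (Set.range (ι ≫ Proj.map φ hφ')) →
          (∀ (X' X'' : Scheme.{0}) (σ' : X' ⟶ Proj (homogeneousSubmodule (Fin (n + 1)) O)) (Y' : Set X')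
            (C : X'.IdealSheafData) (τ : X'' ⟶ X'), Q X' σ' Y' → IsBlowup τ C → Scheme.IsRegular C.subscheme →
            Flat (C.subschemeι ≫ σ' ≫ Proj.toSpecZero (homogeneousSubmodule (Fin (n + 1)) O) ≫
              Spec.map (CommRingCat.ofHom (algebraMap O (homogeneousSubmodule (Fin (n + 1)) O 0)))) →
            σ' '' (C.support : Set X') ⊆ {x | ¬ IsGenericPoint x (Set.range (ι ≫ Proj.map φ hφ'))} →
            (C.support : Set X') ∩ (σ' ≫ Proj.toSpecZero (homogeneousSubmodule (Fin (n + 1)) O) ≫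
              Spec.map (CommRingCat.ofHom (algebraMap O (homogeneousSubmodule (Fin (n + 1)) O 0)))) ⁻¹'
              {IsLocalRing.closedPoint O} ⊆ Y' →
            Q X'' (τ ≫ σ') (closure (τ ⁻¹' (Y' \ (C.support : Set X'))))) → Q X₁ σ₁ S₁) →
        IsLocallyNoetherian X₁ → Scheme.IsRegular X₁ →
        IsProper (σ₁ ≫ Proj.toSpecZero (homogeneousSubmodule (Fin (n + 1)) O) ≫
          Spec.map (CommRingCat.ofHom (algebraMap O (homogeneousSubmodule (Fin (n + 1)) O 0)))) →
        IsClosed S₁ → IsIrreducible S₁ →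
        S₁ ⊆ (σ₁ ≫ Proj.toSpecZero (homogeneousSubmodule (Fin (n + 1)) O) ≫
          Spec.map (CommRingCat.ofHom (algebraMap O (homogeneousSubmodule (Fin (n + 1)) O 0)))) ⁻¹'
          {IsLocalRing.closedPoint O} →
        ∀ D : ((vanishingIdeal (⟨closure S₁, isClosed_closure⟩ : Closeds X₁)).subscheme).IdealSheafData,
          (D.support : Set ↥(vanishingIdeal (⟨closure S₁, isClosed_closure⟩ : Closeds X₁)).subscheme) ⊆
            (Scheme.regularLocus (vanishingIdeal (⟨closure S₁, isClosed_closure⟩ : Closeds X₁)).subscheme)ᶜ →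
          ∃ C : X₁.IdealSheafData, Scheme.IsRegular C.subscheme ∧
            Flat (C.subschemeι ≫ σ₁ ≫ Proj.toSpecZero (homogeneousSubmodule (Fin (n + 1)) O) ≫
              Spec.map (CommRingCat.ofHom (algebraMap O (homogeneousSubmodule (Fin (n + 1)) O 0)))) ∧
            (C.support : Set X₁) ∩ (σ₁ ≫ Proj.toSpecZero (homogeneousSubmodule (Fin (n + 1)) O) ≫
              Spec.map (CommRingCat.ofHom (algebraMap O (homogeneousSubmodule (Fin (n + 1)) O 0)))) ⁻¹'
              {IsLocalRing.closedPoint O} ⊆ S₁ ∧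
            C.comap (vanishingIdeal (⟨closure S₁, isClosed_closure⟩ : Closeds X₁)).subschemeι = D) :
    Theorems.EquisingularLift.ELNatOver p k n H ι O π := by
  obtain ⟨H', ρ, hρ, hreg⟩ := hres
  refine elNatOver_of_exactShadow k n H ι O π hπ (fun _ _ => True) (fun _ _ _ _ _ => trivial)
    ⟨H', fun R h0 hs => reaches_of_isSingularBlowupSequence hρ R h0
      (fun Γ₁ Γ₂ D υ hR hD hυ => hs Γ₁ Γ₂ D υ hR hD trivial hυ), hreg⟩ ?_
  intro φ hφ' hφ X₁ σ₁ S₁ hH hN hR hpr hcl hirr hsub D hD _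
  exact hMS φ hφ' hφ X₁ σ₁ S₁ hH hN hR hpr hcl hirr hsub D hD

/-- **`ELNatAt` FROM A DOWNSTAIRS `IsSingularBlowupSequence` WITH EXACT ADMISSIBLE LIFTS** — the same packaged with
`elNatAt_of_elNatOver`. [folklore] -/
theorem elNatAt_of_isSingularBlowupSequence {p : ℕ} (k : Type) [Field k] [CharP k p] [IsAlgClosed k] (n : ℕ)
    (H : Scheme.{0}) (ι : H ⟶ (Literature.AlgebraicGeometry.Motives.projectiveSpace n k).left) [IsClosedImmersion ι]
    [IsIntegral H] (O : Type) [CommRing O] [IsDomain O] [IsDiscreteValuationRing O] [CharZero O] (π : O →+* k)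
    (hπ : Function.Surjective π)
    (hres : ∃ (H' : Scheme.{0}) (ρ : H' ⟶ H), IsSingularBlowupSequence ρ ∧ Scheme.IsRegular H')
    (hMS : letI := MvPolynomial.gradedAlgebra (σ := Fin (n + 1)) (R := O);
      letI := MvPolynomial.gradedAlgebra (σ := Fin (n + 1)) (R := k);
      ∀ (φ : homogeneousSubmodule (Fin (n + 1)) O →+*ᵍ homogeneousSubmodule (Fin (n + 1)) k)
        (hφ' : HomogeneousIdeal.irrelevant (homogeneousSubmodule (Fin (n + 1)) k) ≤
          (HomogeneousIdeal.irrelevant (homogeneousSubmodule (Fin (n + 1)) O)).map φ),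
        (∀ s, φ s = MvPolynomial.map π s) →
      ∀ (X₁ : Scheme.{0}) (σ₁ : X₁ ⟶ Proj (homogeneousSubmodule (Fin (n + 1)) O)) (S₁ : Set X₁),
        (∀ Q : (∀ X' : Scheme.{0}, (X' ⟶ Proj (homogeneousSubmodule (Fin (n + 1)) O)) → Set X' → Prop),
          Q (Proj (homogeneousSubmodule (Fin (n + 1)) O)) (𝟙 _) (Set.range (ι ≫ Proj.map φ hφ')) →
          (∀ (X' X'' : Scheme.{0}) (σ' : X' ⟶ Proj (homogeneousSubmodule (Fin (n + 1)) O)) (Y' : Set X')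
            (C : X'.IdealSheafData) (τ : X'' ⟶ X'), Q X' σ' Y' → IsBlowup τ C → Scheme.IsRegular C.subscheme →
            Flat (C.subschemeι ≫ σ' ≫ Proj.toSpecZero (homogeneousSubmodule (Fin (n + 1)) O) ≫
              Spec.map (CommRingCat.ofHom (algebraMap O (homogeneousSubmodule (Fin (n + 1)) O 0)))) →
            σ' '' (C.support : Set X') ⊆ {x | ¬ IsGenericPoint x (Set.range (ι ≫ Proj.map φ hφ'))} →
            (C.support : Set X') ∩ (σ' ≫ Proj.toSpecZero (homogeneousSubmodule (Fin (n + 1)) O) ≫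
              Spec.map (CommRingCat.ofHom (algebraMap O (homogeneousSubmodule (Fin (n + 1)) O 0)))) ⁻¹'
              {IsLocalRing.closedPoint O} ⊆ Y' →
            Q X'' (τ ≫ σ') (closure (τ ⁻¹' (Y' \ (C.support : Set X'))))) → Q X₁ σ₁ S₁) →
        IsLocallyNoetherian X₁ → Scheme.IsRegular X₁ →
        IsProper (σ₁ ≫ Proj.toSpecZero (homogeneousSubmodule (Fin (n + 1)) O) ≫
          Spec.map (CommRingCat.ofHom (algebraMap O (homogeneousSubmodule (Fin (n + 1)) O 0)))) →
        IsClosed S₁ → IsIrreducible S₁ →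
        S₁ ⊆ (σ₁ ≫ Proj.toSpecZero (homogeneousSubmodule (Fin (n + 1)) O) ≫
          Spec.map (CommRingCat.ofHom (algebraMap O (homogeneousSubmodule (Fin (n + 1)) O 0)))) ⁻¹'
          {IsLocalRing.closedPoint O} →
        ∀ D : ((vanishingIdeal (⟨closure S₁, isClosed_closure⟩ : Closeds X₁)).subscheme).IdealSheafData,
          (D.support : Set ↥(vanishingIdeal (⟨closure S₁, isClosed_closure⟩ : Closeds X₁)).subscheme) ⊆
            (Scheme.regularLocus (vanishingIdeal (⟨closure S₁, isClosed_closure⟩ : Closeds X₁)).subscheme)ᶜ →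
          ∃ C : X₁.IdealSheafData, Scheme.IsRegular C.subscheme ∧
            Flat (C.subschemeι ≫ σ₁ ≫ Proj.toSpecZero (homogeneousSubmodule (Fin (n + 1)) O) ≫
              Spec.map (CommRingCat.ofHom (algebraMap O (homogeneousSubmodule (Fin (n + 1)) O 0)))) ∧
            (C.support : Set X₁) ∩ (σ₁ ≫ Proj.toSpecZero (homogeneousSubmodule (Fin (n + 1)) O) ≫
              Spec.map (CommRingCat.ofHom (algebraMap O (homogeneousSubmodule (Fin (n + 1)) O 0)))) ⁻¹'
              {IsLocalRing.closedPoint O} ⊆ S₁ ∧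
            C.comap (vanishingIdeal (⟨closure S₁, isClosed_closure⟩ : Closeds X₁)).subschemeι = D) :
    Theorems.EquisingularLift.ELNatAt p k n H ι :=
  Theorems.EquisingularLift.elNatAt_of_elNatOver hπ
    (elNatOver_of_isSingularBlowupSequence k n H ι O π hπ hres hMS)

end Summit.ResolutionOfSingularities.ResolutionOfSingularities.Cruxes.EquisingularLiftNat.Sections

end
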